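import Literature.MathematicalPhysics.QuantumFieldTheory.Balaban1983to89.Node00.OpsYSiteIndexOfRecord
import Literature.MathematicalPhysics.QuantumFieldTheory.Balaban1983to89.B9SectBAllBlocksGeometryY

/-!
# `Balaban1983to89.Node00.OpsYBlockPinOfRecord` — THE BLOCK KEY OF RECORD `blkOfSK : (z, ν, a, c) ↦ Δ(z)` OF THE SITE SECTOR INTO n06-c's
# ALL-BLOCKS GEOMETRY `geoBK ∕ geoBY` (every block of `𝔅`, orphan blocks included, is a key value), ITS READING LAWS (hypothesis-free `off ∕ bound`,
# the (3.41) prefactor), AND THE DICTIONARY WITH THE INDEX-BOND KEY OF RECORD `blkSK (sIK bI)` ALONG `β`: prefactors EQUAL, keys EQUAL on carrier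
# blocks, distances within `1`, decay factors within `e^{δ}` (NODE 00, owner file of the `OpsY` instance; definition module, count-neutral)

T. Bałaban, *Propagators and renormalization transformations for lattice gauge theories. II*, Commun. Math. Phys. **96** (1984) 223–250
[`Balaban1984PropagatorsII`, "[4]"]: (2.1)–(2.4) p. 224 (the sequence of domains `Ω_j`, the blocks `B^j(y)` of side `L^j`; (2.3): *"Λ_j also denotes the
set of bonds with at least one end-point in Λ_j"*), (2.45)–(2.46) p. 231 (*"𝔅 = ⋃_j Λ_j"*, the blocks `Δ(y)`, *"d(x, x′) = d(y, y′) if x ∈ B^j(y)"* — the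
block of a SITE, and the distance `d(y, y′)`), (2.51) p. 232 (*"|(Tλ)(x)| ≤ K(y, y′)|λ|, x ∈ B^j(y), supp λ ⊂ B^{j′}(y′)"* — majorants are keyed by the
BLOCK OF THE EVALUATION SITE), (2.54) p. 233 (the triangle inequality of `d`), p. 248 (*"sites replaced by bonds"*).  T. Bałaban, *Propagators for lattice
gauge theories in a background field*, Commun. Math. Phys. **99** (1985) 389–434 [`Balaban1985BackgroundPropagators`, "[B9]"]: p. 397 (*"Here y, y′ ∈
𝔅 = ⋃_{j=0}^k Λ_j"*), (3.41) p. 397 (the weights `(Lʲη)^{−α}`), (3.42) p. 397 (*«for x ∈ Δ(y), y ∈ Λ_j, supp λ ⊂ Δ(y′)»* — the local estimates, block by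
block over `𝔅`), (3.87)–(3.90) pp. 408–409 (the random-walk letters, read at blocks), p. 399 l. 2–4 (uniformity of the constants in `{Ω_j}`).

statement-level skeleton of published theorems with citation tags; proofs where landed; nothing here is a claim about the
Yang–Mills mass gap

THE POINT (dag-n06-d g22, bus 2026-08-30T08:09Z: *«LOCATED-28 … is now UNPARKED on my side … whenever your `blkOf`-keyed re-key object exists I fold it
in one edition»*).  The N06 certificate's walk letters of record `B9WalkLettersOps.opsWalkY x … bI : Ops (geo9Y x) …` key the site sector by INDEX BONDS:
`blk := blkSK (sIK bI)` (`(z, ν, a, c) ↦ bI ⟨z, e₀⟩ ∈ Λ_{j}` of [4] (2.3)), and the rows-18 bridges then display the exact section law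
`hβs : ∀ z, β (sIK bI z) = Δ(z)` — which NODE 00 has shown FALSE at the cornered members of print's family for every `bI`
(`Node00.OpsYSiteIndexOfRecord.not_forall_memberY_sIK_bIYOfRecord_section`, `Node00.MemberYCornered`).  Print keys (2.51)∕(3.42) by THE BLOCK OF THE
SITE, `y = y(x)`, `x ∈ Δ(y)`, over ALL of `𝔅`.  n06-c (g10) has typed the all-blocks [B9] Sect. A geometry `B9SectBAllBlocksGeometryY.geoBK i ∕ geoBY x`
(sites `= 𝔅 = ↥(bset i.D.toDomains) = Node00.BlkY i`, `dist = d_T`, localisations read AT the block, `geo9K` its pull-back along `β`).  THIS FILE is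
NODE 00's `blkOf`-keyed object for the re-key, in that geometry's currency:
* §1 ★ **THE BLOCK KEY OF RECORD** `blkOfSK i : XSK κ i → (geoBK i).Site`, `(z, ν, a, c) ↦ Δ(z) := blkOf i.D.toDomains z` — CANONICAL (no bond map `bI`,
  no choice), ONTO `𝔅` (`blkOfSK_surjective_sites ∕ exists_blkOfSK_eq`: every block, orphan ones included, is a key value — the property `β ∘ sIK bI`
  lacks), with `scale (blkOfSK p) = j(z)` (`rfl`) and the (3.41) prefactor `len (blkOfSK p) = L^{j(z)}|c_f|⁻¹ = lenSZ i z` (`len_blkOfSK`); and its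
  READING LAWS for n06-k's site-sector evaluation `evSK`, HYPOTHESIS-FREE (★ `off_bound_evSK_blkOfSK`: `suppIn λ s → blkOfSK p ≠ s → evSK λ p = 0` and
  `|evSK λ p| ≤ supNorm λ` — the `off ∕ bound ∕ norm_nonneg` fields of a `B9Thm310Whole.WalkReading (geoBK i)` keyed by `blkOfSK`, where the index-bond
  key needs the carrier-faithfulness binder `hσI` of `B9CoReadingCoordsS.off_bound_evSK`);
* §2 ★★ **THE DICTIONARY WITH THE INDEX-BOND KEY OF RECORD** `blkSK (sIK (bIOfRecord i))` along the carrier-block map `β` (everything at EVERY member and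
  EVERY carrier point, no corner-freeness): the (3.41)∕(3.42) PREFACTORS ARE EQUAL (`len_blkSK_sIK_eq_len_blkOfSK`: `(geo9K i).len (blkSK … p) = (geoBK i).len
  (blkOfSK p)`), the scales are equal (`scale_beta_blkSK_sIK`), the keys AGREE on carrier blocks (`beta_blkSK_sIK_eq_blkOfSK_of_exists`: `Δ(z) ∈ range β →
  β (blkSK … p) = blkOfSK p`) and everywhere iff the member is corner-free (`beta_blkSK_sIK_eq_blkOfSK_of_surjective`, with
  `OpsYSiteIndexOfRecord.sIK_bIOfRecord_section_iff`), the two key blocks are within torus distance `1` (`dist_beta_blkSK_sIK_blkOfSK_le_one`), hence for every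
  block `t`: `|d(β (blkSK … p), t) − d(blkOfSK p, t)| ≤ 1` (`abs_dist_beta_blkSK_sub_dist_blkOfSK_le_one`, by (2.54)), in the record's own currency
  `|(geo9K i).dist (blkSK … p) c − (geoBK i).dist (blkOfSK p) (β c)| ≤ 1` (`abs_dist_geo9K_sub_dist_blkOfSK_le_one`, n06-c's `dist_beta`), and the (3.42)
  decay factors compare within `e^{δ}` both ways (`exp_dist_blkOfSK_le ∕ exp_dist_beta_blkSK_le`, `0 ≤ δ`);
* §3 the same at the record `θ : Stage3Params` in the certificate's binder text (`x : MemberY θ.d₆ …`, geometry `geoBY x`, `bI := bIYOfRecord θ M⋆ x`):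
  `blkOfSK_geoBY_apply`, `len_blkSK_sIK_bIYOfRecord_eq`, `beta_blkSK_sIK_bIYOfRecord_eq_of_exists`, `dist_beta_blkSK_sIK_bIYOfRecord_le_one`,
  `abs_dist_geo9Y_sub_dist_blkOfSK_le_one`.
WHAT THIS DOES NOT DO (honest scope, LOCATED-28 restated): it does NOT transfer a `HasMajorant` table from one key to the other (that needs, besides §2, the
neighbour-block count of the torus lineage — an M-sized lemma nobody has asked for), and it does NOT supply (3.42) tables at orphan blocks — the `EBlock`
currency of record reads `range β` only; all-blocks tables are n06-c's PLAN (γ′) (`B9SectBAllBlocksWriteY`) ∕ the cube-family road, not NODE 00's.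

HONEST SCOPE.  One definition (`blkOfSK`, a projection composed with N03's `blkOf`) and lattice bookkeeping over the tree's own domain datum, n06-c's
geometry and NODE 00's landed laws of the bond map of record; nothing of [4] or [B9] asserted; no bridge, frame or certificate re-typed (n06-d's edition);
helper, COUNT-NEUTRAL (0 new named facts); N06 NOT discharged; K1⁹ NOT closed; one finite `𝕋^{d+1}` programme at fixed `ε` — nothing continuum, nothing
about OS axioms or the mass gap.  Cell `pub-ymgap` (HUMAN RULING D-0062), NODE 00 `pub-ymgap-node00-def-Y` (g30), 2026-08-30; filed
`--supports stmt-QuantumFields-20541`.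
-/

noncomputable section

namespace Literature.MathematicalPhysics.QuantumFieldTheory.Balaban1983to89.Node00.OpsYBlockPinOfRecord

open Node00
open B6Geom246MultiLevelBox (bset blkOf exists_blkOf_eq)
open B6Geom246MultiLevelTorus (geomT)
open B6Ineq2142KLevelV1 (lvl β)
open B6KLevelCensusIndexV1 (KIdx)
open B9PinMembersKLevelV1 (MemberY geo9Y)
open B9GeoNormsKLevelV1 (geo9K geo9K_supNorm_nonneg)
open B9CoReadingCoords (evDiagK abs_evDiagK_le evDiagK_eq_zero_of)
open B9CoReadingCoordsS (XSK evSK blkSK sIK lenSZ len_blkSK_eq)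
open B9SectBAllBlocksGeometryY (geoBK geoBY dist_beta scale_beta len_beta geoBK_dist_comm geoBK_dist_triangle geoBK_dist_nonneg)
open Node00.OpsYBondMapOfRecord (bIOfRecord bIYOfRecord)
open Node00.OpsYSiteIndexOfRecord (sIK_bIOfRecord_faithful sIK_bIOfRecord_level sIK_bIOfRecord_dist_le_one sIK_bIOfRecord_section_of_surjective)

variable {d ℓ : ℕ} {hd : 1 ≤ d + 1} {hL : Odd (ℓ + 1) ∧ 1 < ℓ + 1} {b₀ b₁ : ℝ}
variable {κ : Type}

/-! ## §1 The block key of record of the site sector, into the all-blocks geometry; its reading laws -/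

section Index

variable (i : KIdx d ℓ hd hL b₀ b₁)

variable (κ) in
/-- ★ **THE BLOCK KEY OF RECORD of the site sector**: the coordinate point `(z, ν, a, c)` of n06-k's carrier `XSK κ i` is keyed by THE BLOCK OF ITS SITE,
`Δ(z) = blkOf z ∈ 𝔅`, a site of n06-c's all-blocks geometry `geoBK i` (print's `x ∈ Δ(y)`, `y ∈ 𝔅`; no bond map, no choice).
[cite: Balaban1984PropagatorsII, (2.45)–(2.46) p.231 («d(x, x′) = d(y, y′) if x ∈ B^j(y)»), (2.51) p.232; Balaban1985BackgroundPropagators, (3.42) p.397 («x ∈ Δ(y)»)] -/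
def blkOfSK : XSK κ i → (geoBK i).Site := fun p => blkOf i.D.toDomains p.1

/-- `blkOfSK`, evaluated. [cite: Balaban1984PropagatorsII, (2.45) p.231, bookkeeping] -/
@[simp] theorem blkOfSK_apply (p : XSK κ i) : blkOfSK κ i p = blkOf i.D.toDomains p.1 := rfl

/-- the key equation IS the block equation of the site. [cite: Balaban1984PropagatorsII, (2.45) p.231, bookkeeping] -/
theorem blkOfSK_eq_iff (p : XSK κ i) (s : (geoBK i).Site) : blkOfSK κ i p = s ↔ blkOf i.D.toDomains p.1 = s := Iff.rfl

/-- ★ EVERY block of `𝔅` — orphan blocks of an inner corner included — is the block of some site (N03's `exists_blkOf_eq`, in `geoBK` typing).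
[cite: Balaban1984PropagatorsII, (2.45) p.231 («𝔅 = ⋃_j Λ_j»)] -/
theorem blkOfSK_surjective_sites : Function.Surjective (fun z : SiteY i => (blkOf i.D.toDomains z : (geoBK i).Site)) :=
  fun s => exists_blkOf_eq (D := i.D.toDomains) s

/-- ★ … hence every block is a value of the key `blkOfSK` in every slot `(ν, a, c)`. [cite: Balaban1984PropagatorsII, (2.45) p.231] -/
theorem exists_blkOfSK_eq (s : (geoBK i).Site) (ν : Fin (d + 1)) (a c : κ) : ∃ z : SiteY i, blkOfSK κ i (z, ν, a, c) = s :=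
  exists_blkOf_eq (D := i.D.toDomains) s

/-- the scale of the key block is the level `j(z)` of the site (`rfl`). [cite: Balaban1984PropagatorsII, (2.3)–(2.4) p.224, (2.45) p.231] -/
theorem scale_blkOfSK (p : XSK κ i) : (geoBK i).scale (blkOfSK κ i p) = (blkOf i.D.toDomains p.1).1.1 := rfl

/-- ★ the (3.41) prefactor at the key block IS n06-k's `lenSZ i z = L^{j(z)}|c_f|⁻¹` — the value `B9CoReadingCoordsS.len_blkSK_eq` gives the index-bond key
under level-faithfulness; so the rows-18 prefactors are key-independent. [cite: Balaban1985BackgroundPropagators, (3.41)–(3.42) p.397] -/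
theorem len_blkOfSK (p : XSK κ i) : (geoBK i).len (blkOfSK κ i p) = lenSZ i p.1 := by
  show (((ℓ + 1 : ℕ) : ℝ)) ^ (blkOf i.D.toDomains p.1).1.1 * |i.cf|⁻¹ = _
  rw [lenSZ]
  push_cast
  rfl

/-- `0 < len (blkOfSK p)`. [cite: Balaban1985BackgroundPropagators, (3.41) p.397, bookkeeping] -/
theorem len_blkOfSK_pos (p : XSK κ i) : 0 < (geoBK i).len (blkOfSK κ i p) := by
  rw [len_blkOfSK]; exact B9CoReadingCoordsS.lenSZ_pos i p.1

/-- ★ **THE READING LAWS UNDER THE BLOCK KEY, HYPOTHESIS-FREE**: n06-k's site-sector evaluation `evSK` is OFF outside the localising block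
(`suppIn λ s`, read AT the block `s` by `geoBK`, and `Δ(z) ≠ s` give `evSK λ (z, …) = 0`) and BOUNDED by `supNorm λ` — the `off ∕ bound` fields of a walk
reading keyed by `blkOfSK` (compare `B9CoReadingCoordsS.off_bound_evSK`, which needs the carrier-faithfulness binder `hσI` for an index-bond key).
[cite: Balaban1985BackgroundPropagators, (3.42) p.397 («supp λ ⊂ Δ(y′)», «|λ|»); Balaban1984PropagatorsII, (2.51) p.232] -/
theorem off_bound_evSK_blkOfSK [DecidableEq κ] :
    (∀ (lam : (geoBK i).Loc) (s : (geoBK i).Site), (geoBK i).suppIn lam s → ∀ p : XSK κ i, blkOfSK κ i p ≠ s → evSK (κ := κ) i lam p = 0) ∧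
    (∀ (lam : (geoBK i).Loc) (p : XSK κ i), |evSK (κ := κ) i lam p| ≤ (geoBK i).supNorm lam) := by
  refine ⟨?_, ?_⟩
  · intro lam s hs p hne
    cases lam with
    | inr J => rfl
    | inl f =>
        refine evDiagK_eq_zero_of ?_
        by_contra hf
        exact hne (hs p.1 hf)
  · intro lam p
    cases lam with
    | inr J => show |(0 : ℝ)| ≤ _; rw [abs_zero]; exact geo9K_supNorm_nonneg i _
    | inl f => exact (abs_evDiagK_le f p).trans (le_ciSup (f := fun x => |f x|) (Set.finite_range _).bddAbove p.1)

/-- `0 ≤ supNorm λ` on `geoBK` (the norm fields are those of the record). [cite: Balaban1985BackgroundPropagators, (3.41) p.397, bookkeeping] -/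
theorem geoBK_supNorm_nonneg (lam : (geoBK i).Loc) : 0 ≤ (geoBK i).supNorm lam := geo9K_supNorm_nonneg i lam

/-! ## §2 The dictionary with the index-bond key of record `blkSK (sIK (bIOfRecord i))` along `β` -/

/-- ★ **ON CARRIER BLOCKS THE TWO KEYS AGREE**: if `Δ(z)` carries an index bond, `β (blkSK (sIK bI) p) = blkOfSK p` at `bI := bIOfRecord i`.
[cite: Balaban1984PropagatorsII, (2.45)–(2.46) p.231; Balaban1985BackgroundPropagators, (3.42) p.397] -/
theorem beta_blkSK_sIK_eq_blkOfSK_of_exists (p : XSK κ i) (h : ∃ c : IBondY i, blkOf i.D.toDomains p.1 = β i.hN i.D i.hk c) :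
    β i.hN i.D i.hk (blkSK i (sIK i (bIOfRecord i)) p) = blkOfSK κ i p := by
  obtain ⟨c, hc⟩ := h
  exact sIK_bIOfRecord_faithful i p.1 c hc

/-- at a corner-free member (`β` onto `𝔅`) the two keys agree EVERYWHERE. [cite: Balaban1984PropagatorsII, (2.45)–(2.46) p.231 + p.248] -/
theorem beta_blkSK_sIK_eq_blkOfSK_of_surjective (hβ : Function.Surjective (β i.hN i.D i.hk)) (p : XSK κ i) :
    β i.hN i.D i.hk (blkSK i (sIK i (bIOfRecord i)) p) = blkOfSK κ i p :=
  sIK_bIOfRecord_section_of_surjective i hβ p.1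

/-- the SCALES of the two key blocks are equal at every point (level-faithfulness + [4] (2.3)). [cite: Balaban1984PropagatorsII, (2.3)–(2.4) p.224, (2.45) p.231] -/
theorem scale_beta_blkSK_sIK (p : XSK κ i) :
    (geoBK i).scale (β i.hN i.D i.hk (blkSK i (sIK i (bIOfRecord i)) p)) = (geoBK i).scale (blkOfSK κ i p) := by
  rw [← scale_beta]
  exact sIK_bIOfRecord_level i p.1

/-- ★★ **THE (3.41)∕(3.42) PREFACTORS ARE KEY-INDEPENDENT**: `(geo9K i).len (blkSK (sIK bI) p) = (geoBK i).len (blkOfSK p)` at `bI := bIOfRecord i`, every `p`.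
[cite: Balaban1985BackgroundPropagators, (3.41)–(3.42) p.397; Balaban1984PropagatorsII, (2.3) p.224] -/
theorem len_blkSK_sIK_eq_len_blkOfSK (p : XSK κ i) :
    (geo9K i).len (blkSK i (sIK i (bIOfRecord i)) p) = (geoBK i).len (blkOfSK κ i p) := by
  rw [len_blkSK_eq i (sIK_bIOfRecord_level i), len_blkOfSK]

/-- the same through n06-c's pull-back identity `len_beta`. [cite: Balaban1985BackgroundPropagators, (3.41) p.397, bookkeeping] -/
theorem len_beta_blkSK_sIK_eq_len_blkOfSK (p : XSK κ i) :
    (geoBK i).len (β i.hN i.D i.hk (blkSK i (sIK i (bIOfRecord i)) p)) = (geoBK i).len (blkOfSK κ i p) := by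
  rw [← len_beta]; exact len_blkSK_sIK_eq_len_blkOfSK i p

/-- ★ **1-FAITHFUL**: the two key blocks are within torus distance `1`, at EVERY point (orphan blocks included).
[cite: Balaban1984PropagatorsII, (2.46) p.231; Balaban1985BackgroundPropagators, (3.42) p.397] -/
theorem dist_beta_blkSK_sIK_blkOfSK_le_one (p : XSK κ i) :
    (geoBK i).dist (β i.hN i.D i.hk (blkSK i (sIK i (bIOfRecord i)) p)) (blkOfSK κ i p) ≤ 1 :=
  sIK_bIOfRecord_dist_le_one i p.1

/-- … symmetrically. [cite: Balaban1984PropagatorsII, (2.46) p.231, bookkeeping] -/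
theorem dist_blkOfSK_beta_blkSK_sIK_le_one (p : XSK κ i) :
    (geoBK i).dist (blkOfSK κ i p) (β i.hN i.D i.hk (blkSK i (sIK i (bIOfRecord i)) p)) ≤ 1 := by
  rw [geoBK_dist_comm]; exact dist_beta_blkSK_sIK_blkOfSK_le_one i p

/-- distances FROM the block key are within `1` of those from the index-bond key's carrier block ((2.54)). [cite: Balaban1984PropagatorsII, (2.54) p.233, (2.46) p.231] -/
theorem dist_blkOfSK_le_add_one (p : XSK κ i) (t : (geoBK i).Site) :
    (geoBK i).dist (blkOfSK κ i p) t ≤ (geoBK i).dist (β i.hN i.D i.hk (blkSK i (sIK i (bIOfRecord i)) p)) t + 1 := by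
  have h1 := dist_blkOfSK_beta_blkSK_sIK_le_one (κ := κ) i p
  have h2 := geoBK_dist_triangle i (blkOfSK κ i p) (β i.hN i.D i.hk (blkSK i (sIK i (bIOfRecord i)) p)) t
  linarith

/-- … and conversely. [cite: Balaban1984PropagatorsII, (2.54) p.233, (2.46) p.231] -/
theorem dist_beta_blkSK_sIK_le_add_one (p : XSK κ i) (t : (geoBK i).Site) :
    (geoBK i).dist (β i.hN i.D i.hk (blkSK i (sIK i (bIOfRecord i)) p)) t ≤ (geoBK i).dist (blkOfSK κ i p) t + 1 := by
  have h1 := dist_beta_blkSK_sIK_blkOfSK_le_one (κ := κ) i p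
  have h2 := geoBK_dist_triangle i (β i.hN i.D i.hk (blkSK i (sIK i (bIOfRecord i)) p)) (blkOfSK κ i p) t
  linarith

/-- ★ `|d(β (blkSK (sIK bI) p), t) − d(blkOfSK p, t)| ≤ 1` for every block `t`. [cite: Balaban1984PropagatorsII, (2.54) p.233, (2.46) p.231] -/
theorem abs_dist_beta_blkSK_sub_dist_blkOfSK_le_one (p : XSK κ i) (t : (geoBK i).Site) :
    |(geoBK i).dist (β i.hN i.D i.hk (blkSK i (sIK i (bIOfRecord i)) p)) t - (geoBK i).dist (blkOfSK κ i p) t| ≤ 1 := by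
  rw [abs_sub_le_iff]
  constructor
  · linarith [dist_beta_blkSK_sIK_le_add_one (κ := κ) i p t]
  · linarith [dist_blkOfSK_le_add_one (κ := κ) i p t]

/-- ★★ **IN THE RECORD'S OWN CURRENCY**: the (3.42) distance the certificate reads today, `(geo9K i).dist (blkSK (sIK bI) p) c`, and the all-blocks distance
under the block key, `(geoBK i).dist (blkOfSK p) (β c)`, differ by at most `1` (n06-c's `dist_beta` + (2.54)). [cite: Balaban1984PropagatorsII, (2.46) p.231, (2.54) p.233; Balaban1985BackgroundPropagators, (3.42) p.397] -/
theorem abs_dist_geo9K_sub_dist_blkOfSK_le_one (p : XSK κ i) (c : IBondY i) :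
    |(geo9K i).dist (blkSK i (sIK i (bIOfRecord i)) p) c - (geoBK i).dist (blkOfSK κ i p) (β i.hN i.D i.hk c)| ≤ 1 := by
  rw [dist_beta]
  exact abs_dist_beta_blkSK_sub_dist_blkOfSK_le_one i p _

/-- ★ the (3.42) DECAY FACTORS compare within `e^{δ}`: `e^{−δ·d(blkOfSK p, t)} ≤ e^{δ}·e^{−δ·d(β (blkSK (sIK bI) p), t)}` (`0 ≤ δ`).
[cite: Balaban1985BackgroundPropagators, (3.42) p.397; Balaban1984PropagatorsII, (2.51) p.232, (2.54) p.233] -/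
theorem exp_dist_blkOfSK_le {δ : ℝ} (hδ : 0 ≤ δ) (p : XSK κ i) (t : (geoBK i).Site) :
    Real.exp (-(δ * (geoBK i).dist (blkOfSK κ i p) t)) ≤
      Real.exp δ * Real.exp (-(δ * (geoBK i).dist (β i.hN i.D i.hk (blkSK i (sIK i (bIOfRecord i)) p)) t)) := by
  rw [← Real.exp_add, Real.exp_le_exp]
  have h := mul_le_mul_of_nonneg_left (dist_beta_blkSK_sIK_le_add_one (κ := κ) i p t) hδ
  linarith

/-- … and conversely `e^{−δ·d(β (blkSK (sIK bI) p), t)} ≤ e^{δ}·e^{−δ·d(blkOfSK p, t)}`. [cite: Balaban1985BackgroundPropagators, (3.42) p.397; Balaban1984PropagatorsII, (2.54) p.233] -/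
theorem exp_dist_beta_blkSK_le {δ : ℝ} (hδ : 0 ≤ δ) (p : XSK κ i) (t : (geoBK i).Site) :
    Real.exp (-(δ * (geoBK i).dist (β i.hN i.D i.hk (blkSK i (sIK i (bIOfRecord i)) p)) t)) ≤
      Real.exp δ * Real.exp (-(δ * (geoBK i).dist (blkOfSK κ i p) t)) := by
  rw [← Real.exp_add, Real.exp_le_exp]
  have h := mul_le_mul_of_nonneg_left (dist_blkOfSK_le_add_one (κ := κ) i p t) hδ
  linarith

/-- the record-currency form: `e^{−δ·(geoBK).dist (blkOfSK p) (β c)} ≤ e^{δ}·e^{−δ·(geo9K).dist (blkSK (sIK bI) p) c}`.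
[cite: Balaban1985BackgroundPropagators, (3.42) p.397; Balaban1984PropagatorsII, (2.46) p.231, (2.54) p.233] -/
theorem exp_dist_blkOfSK_beta_le {δ : ℝ} (hδ : 0 ≤ δ) (p : XSK κ i) (c : IBondY i) :
    Real.exp (-(δ * (geoBK i).dist (blkOfSK κ i p) (β i.hN i.D i.hk c))) ≤
      Real.exp δ * Real.exp (-(δ * (geo9K i).dist (blkSK i (sIK i (bIOfRecord i)) p) c)) := by
  rw [dist_beta]; exact exp_dist_blkOfSK_le i hδ p _

end Index

/-! ## §3 At the record `θ : Stage3Params`, in the certificate's binder text (`x : MemberY θ.d₆ …`, `geoBY x`, `bI := bIYOfRecord θ M⋆ x`) -/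

section Record

variable (θ : Stage3Params) (Mstar : ℕ)

/-- the block key at a member of the record, as a key INTO n06-c's `geoBY x` (`= geoBK x.toKIdx`), evaluated. [cite: Balaban1984PropagatorsII, (2.45) p.231, dictionary] -/
theorem blkOfSK_geoBY_apply (x : MemberY θ.d₆ θ.ℓ₆ θ.hd' θ.hL' θ.b₀ θ.b₁ Mstar) (p : XSK κ x.toKIdx) :
    (blkOfSK κ x.toKIdx p : (geoBY x).Site) = blkOf x.toKIdx.D.toDomains p.1 := rfl

/-- ★★ at the record: the (3.41)∕(3.42) prefactors of the two keys are EQUAL (`(geo9Y x).len (blkSK (sIK (bIYOfRecord θ M⋆ x)) p) = (geoBY x).len (blkOfSK p)`).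
[cite: Balaban1985BackgroundPropagators, (3.41)–(3.42) p.397; Balaban1984PropagatorsII, (2.3) p.224] -/
theorem len_blkSK_sIK_bIYOfRecord_eq (x : MemberY θ.d₆ θ.ℓ₆ θ.hd' θ.hL' θ.b₀ θ.b₁ Mstar) (p : XSK κ x.toKIdx) :
    (geo9Y x).len (blkSK x.toKIdx (sIK x.toKIdx (bIYOfRecord θ Mstar x)) p) = (geoBY x).len (blkOfSK κ x.toKIdx p) :=
  len_blkSK_sIK_eq_len_blkOfSK x.toKIdx p

/-- at the record: on carrier blocks the two keys agree. [cite: Balaban1984PropagatorsII, (2.45)–(2.46) p.231; Balaban1985BackgroundPropagators, (3.42) p.397] -/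
theorem beta_blkSK_sIK_bIYOfRecord_eq_of_exists (x : MemberY θ.d₆ θ.ℓ₆ θ.hd' θ.hL' θ.b₀ θ.b₁ Mstar) (p : XSK κ x.toKIdx)
    (h : ∃ c : IBondY x.toKIdx, blkOf x.toKIdx.D.toDomains p.1 = β x.toKIdx.hN x.toKIdx.D x.toKIdx.hk c) :
    β x.toKIdx.hN x.toKIdx.D x.toKIdx.hk (blkSK x.toKIdx (sIK x.toKIdx (bIYOfRecord θ Mstar x)) p) = blkOfSK κ x.toKIdx p :=
  beta_blkSK_sIK_eq_blkOfSK_of_exists x.toKIdx p h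

/-- at the record: the two key blocks are within torus distance `1` at every point. [cite: Balaban1984PropagatorsII, (2.46) p.231; Balaban1985BackgroundPropagators, (3.42) p.397] -/
theorem dist_beta_blkSK_sIK_bIYOfRecord_le_one (x : MemberY θ.d₆ θ.ℓ₆ θ.hd' θ.hL' θ.b₀ θ.b₁ Mstar) (p : XSK κ x.toKIdx) :
    (geoBY x).dist (β x.toKIdx.hN x.toKIdx.D x.toKIdx.hk (blkSK x.toKIdx (sIK x.toKIdx (bIYOfRecord θ Mstar x)) p)) (blkOfSK κ x.toKIdx p) ≤ 1 :=
  dist_beta_blkSK_sIK_blkOfSK_le_one x.toKIdx p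

/-- ★★ at the record, in the certificate's currency: `|(geo9Y x).dist (blkSK (sIK bI) p) c − (geoBY x).dist (blkOfSK p) (β c)| ≤ 1` at `bI := bIYOfRecord θ M⋆ x`.
[cite: Balaban1984PropagatorsII, (2.46) p.231, (2.54) p.233; Balaban1985BackgroundPropagators, (3.42) p.397] -/
theorem abs_dist_geo9Y_sub_dist_blkOfSK_le_one (x : MemberY θ.d₆ θ.ℓ₆ θ.hd' θ.hL' θ.b₀ θ.b₁ Mstar) (p : XSK κ x.toKIdx) (c : IBondY x.toKIdx) :
    |(geo9Y x).dist (blkSK x.toKIdx (sIK x.toKIdx (bIYOfRecord θ Mstar x)) p) c -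
        (geoBY x).dist (blkOfSK κ x.toKIdx p) (β x.toKIdx.hN x.toKIdx.D x.toKIdx.hk c)| ≤ 1 :=
  abs_dist_geo9K_sub_dist_blkOfSK_le_one x.toKIdx p c

/-- at the record: the decay factors compare within `e^{δ}` (`0 ≤ δ`), certificate currency on the right.
[cite: Balaban1985BackgroundPropagators, (3.42) p.397; Balaban1984PropagatorsII, (2.54) p.233] -/
theorem exp_dist_blkOfSK_beta_le_record {δ : ℝ} (hδ : 0 ≤ δ) (x : MemberY θ.d₆ θ.ℓ₆ θ.hd' θ.hL' θ.b₀ θ.b₁ Mstar) (p : XSK κ x.toKIdx)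
    (c : IBondY x.toKIdx) :
    Real.exp (-(δ * (geoBY x).dist (blkOfSK κ x.toKIdx p) (β x.toKIdx.hN x.toKIdx.D x.toKIdx.hk c))) ≤
      Real.exp δ * Real.exp (-(δ * (geo9Y x).dist (blkSK x.toKIdx (sIK x.toKIdx (bIYOfRecord θ Mstar x)) p) c)) :=
  exp_dist_blkOfSK_beta_le x.toKIdx hδ p c

/-- at the record: the reading laws under the block key, hypothesis-free (§1 at `x.toKIdx`). [cite: Balaban1985BackgroundPropagators, (3.42) p.397; Balaban1984PropagatorsII, (2.51) p.232] -/
theorem off_bound_evSK_blkOfSK_record [DecidableEq κ] (x : MemberY θ.d₆ θ.ℓ₆ θ.hd' θ.hL' θ.b₀ θ.b₁ Mstar) :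
    (∀ (lam : (geoBY x).Loc) (s : (geoBY x).Site), (geoBY x).suppIn lam s →
        ∀ p : XSK κ x.toKIdx, blkOfSK κ x.toKIdx p ≠ s → evSK (κ := κ) x.toKIdx lam p = 0) ∧
    (∀ (lam : (geoBY x).Loc) (p : XSK κ x.toKIdx), |evSK (κ := κ) x.toKIdx lam p| ≤ (geoBY x).supNorm lam) :=
  off_bound_evSK_blkOfSK x.toKIdx

end Record

end Literature.MathematicalPhysics.QuantumFieldTheory.Balaban1983to89.Node00.OpsYBlockPinOfRecord
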